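import Literature.AnabelianGeometry.SemiGraphs.ArithThm54CapstoneCorollary
import Literature.AnabelianGeometry.SemiGraphs.ArithTemperedGroupLevelTopology
import Literature.AnabelianGeometry.SemiGraphs.TemperedPiLevelKernelVertGen
import HarnessLib

/-!
# [SemiAnbd] Thm 5.4 (i) ∧ (ii) at `π₁^temp(𝒢) ⋊^out Π_A` — the integrated corollary with the LEVEL-B
# TOPOLOGY BINDERS DISCHARGED by `arithLevelTopology` (T54-B, «E-top» v2 junction; proof-only)

Mochizuki, *Semi-graphs of anabelioids*, Publ. RIMS **42** (2006), §5 Thm 5.4 (i)(ii) p. 66, Prop 5.2 (iv)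
p. 64 (the tempered topology of `Π^temp_𝔊`) [cite: MochizukiSemiAnbd2006, Thm 5.4 (i), p. 66].

PROOF-ONLY junction (abc-iut cell, L3, producer row T54-B = GAP-LEDGER G-w4d053-1; seat abc-iut-w6-d070, owner of
the topology term, sub-row «T54·E-top»).  abc-iut-w4-d089's corollary
`arithMaximalCompactStatement_outerAction_piPresentation_of_producers` (ArithThm54CapstoneCorollary.lean,
p434669) carries the LEVEL-B topology of `E := π₁^temp(𝒢) ⋊^out Π_A` as binders: the instances
`[TopologicalSpace E] [IsTopologicalGroup E] [T2Space E]`, the open tree-level action kernels `hKopen`,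
`IsTempered E` (`hT`) and abc-iut-L3-d2's neighbourhood basis `hb`.  Here ALL SIX are discharged BY NAME at
`arithLevelTopology` (ArithTemperedGroupLevelTopology.lean, p431501: `arithLevelTopology_isTopologicalGroup`,
`arithLevelTopology_t2Space`, `isOpen_ker_arithAct`, `isTempered_arithLevelTopology`,
`arithLevelTopology_nhds_hasBasis`), whose own inputs at the canonical tower are THEOREMS of the tree:
one compact vertex group (`GaloisLevelData.isCompact_piPresentation_H`, abc-iut-w4-d085), tree levels open
(`isOpen_ker_projAut`) and cofinal at `1` (`exists_ker_projAut_subset`, abc-iut-w4-d071), first countability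
of `π₁^temp(𝒢)` (from the chart's `secondCountableTopology`).  The statement keeps a generic instance binder
`[inst : TopologicalSpace E]` pinned by `hinst : inst = arithLevelTopology …` so that the compactness clause of
`stabBranchPairAug` and the conclusion are read in THIS topology.

RESIDUAL binders after the junction = the corollary's, minus the six above, plus `hA : IsTempered Π_A`
(profinite `Π_A`: `IsTempered.of_profinite`) — i.e. `hV hE hopen hBR hP hLst hK1' noSwitchBase stabBranchPairAug
hest hbot`.  Nothing beyond composition is proved; typed ≠ proved for the residual inputs; no side taken on
[IUTchIII] Cor 3.12.
-/

namespace Literature.AnabelianGeometry.SemiGraphs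

namespace ProfiniteSemiGraph

open CategoryTheory Topology Filter
open Literature.AnabelianGeometry.EtaleTheta
open scoped Pointwise

universe u

variable {𝒢 : ProfiniteSemiGraph.{u}}

/-- `π₁^temp(𝒢)` (any chart) is first countable — it is even second countable by the chart's own field
([IUTchI] Rmk. 2.5.3 (i) (T6)). [cite: MochizukiSemiAnbd2006, Prop 3.6 (i), p. 38] -/
theorem TemperedPiChart.firstCountableTopology_G (c : TemperedPiChart 𝒢) : FirstCountableTopology c.G := by
  haveI := c.secondCountableTopology
  infer_instance

/-- **The canonical LEVEL-B topology of `π₁^temp(𝒢) ⋊^out Π_A` at the canonical tower** (all inputs of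
`arithLevelTopology` that are theorems of the tree bound by name; residual: `hA`, `hP`, `hLst`, `hK1'`).
[cite: MochizukiSemiAnbd2006, Prop 5.2 (iv), p. 64] -/
@[reducible] noncomputable def canonicalArithLevelTopology (h37 : 𝒢.Thm37Hypotheses)
    {PA : Type u} [Group PA] [TopologicalSpace PA] [IsTopologicalGroup PA] (hA : IsTempered PA)
    (ρ' : PA →* TopOut (𝒢.temperedPiChart h37.toProp36Hypotheses).G) (baseAct : PA →* Aut 𝒢.graph)
    (T : ∀ w : 𝒢.graph.Vertex, (𝒢.galoisLevelData h37.toProp36Hypotheses).PointSeq h37.toProp36Hypotheses.isCountable w)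
    (R : SemiGraph.RefBranches 𝒢.graph)
    (hP : ((𝒢.galoisLevelData h37.toProp36Hypotheses).piPresentation h37.toProp36Hypotheses.isCountable T R).IsArithCompatible (((contMulAut (𝒢.temperedPiChart h37.toProp36Hypotheses).G).subtype.comp (MonoidHom.fst (contMulAut (𝒢.temperedPiChart h37.toProp36Hypotheses).G) PA)).comp (outerSemidirectProduct ρ').subtype) (baseAct.comp (outerSemidirectProductSnd ρ')))
    (w₀ : 𝒢.graph.Vertex)
    (hLst : ∀ (n : ℕ) (e : outerSemidirectProduct ρ') (x : (𝒢.temperedPiChart h37.toProp36Hypotheses).G), x ∈ ((𝒢.galoisLevelData h37.toProp36Hypotheses).piLevelAut h37.toProp36Hypotheses.isCountable (𝒢.galoisLevelData_hconn h37.toProp36Hypotheses) n).ker → (((contMulAut (𝒢.temperedPiChart h37.toProp36Hypotheses).G).subtype.comp (MonoidHom.fst (contMulAut (𝒢.temperedPiChart h37.toProp36Hypotheses).G) PA)).comp (outerSemidirectProduct ρ').subtype) e x ∈ ((𝒢.galoisLevelData h37.toProp36Hypotheses).piLevelAut h37.toProp36Hypotheses.isCountable (𝒢.galoisLevelData_hconn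 h37.toProp36Hypotheses) n).ker)
    (hK1' : ∀ n, IsOpen (((((𝒢.galoisLevelData h37.toProp36Hypotheses).piPresentation h37.toProp36Hypotheses.isCountable T R).levelKer hP
        ((𝒢.galoisLevelData h37.toProp36Hypotheses).projAut h37.toProp36Hypotheses.isCountable n).ker
        ((𝒢.galoisLevelData h37.toProp36Hypotheses).hKst_of_hLst_outerAction h37.toProp36Hypotheses.isCountable (𝒢.galoisLevelData_hconn h37.toProp36Hypotheses) T R ρ' hP hLst n)).map (outerSemidirectProductSnd ρ') :
      Subgroup PA) : Set PA)) :
    TopologicalSpace (outerSemidirectProduct ρ') :=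
  @arithLevelTopology 𝒢 (𝒢.temperedPiChart h37.toProp36Hypotheses) PA _ _ _ ρ' baseAct
    (TemperedPiChart.firstCountableTopology_G _) h37.toProp36Hypotheses hA
    ((𝒢.galoisLevelData h37.toProp36Hypotheses).piPresentation h37.toProp36Hypotheses.isCountable T R) hP w₀
    ((𝒢.galoisLevelData h37.toProp36Hypotheses).isCompact_piPresentation_H h37.toProp36Hypotheses.isCountable T R w₀)
    (fun n => ((𝒢.galoisLevelData h37.toProp36Hypotheses).projAut h37.toProp36Hypotheses.isCountable n).ker)
    (fun _ => MonoidHom.normal_ker _)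
    ((𝒢.galoisLevelData h37.toProp36Hypotheses).hKst_of_hLst_outerAction h37.toProp36Hypotheses.isCountable (𝒢.galoisLevelData_hconn h37.toProp36Hypotheses) T R ρ' hP hLst)
    ((𝒢.galoisLevelData h37.toProp36Hypotheses).ker_projAut_anti h37.toProp36Hypotheses.isCountable)
    ((𝒢.galoisLevelData h37.toProp36Hypotheses).isOpen_ker_projAut h37.toProp36Hypotheses.isCountable)
    (fun _ hU => (𝒢.galoisLevelData h37.toProp36Hypotheses).exists_ker_projAut_subset h37.toProp36Hypotheses.isCountable hU)
    hK1'

/-- **[SemiAnbd] Thm 5.4 (i) ∧ (ii) at `π₁^temp(𝒢) ⋊^out Π_A` with the LEVEL-B topology binders DISCHARGED**: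
abc-iut-w4-d089's `arithMaximalCompactStatement_outerAction_piPresentation_of_producers` with
`[TopologicalSpace E] := canonicalArithLevelTopology …` (pinned by `hinst`), `[IsTopologicalGroup E]`,
`[T2Space E]`, `hKopen`, `hT`, `hb` supplied by the `arithLevelTopology` package.  Residual binders: `hA`
(`Π_A` tempered), `hV hE hopen hBR` (design data), `hP`, `hLst`, `hK1'`, `noSwitchBase`, `stabBranchPairAug`,
`hest`, `hbot`. [cite: MochizukiSemiAnbd2006, Thm 5.4 (i), p. 66] -/
theorem arithMaximalCompactStatement_outerAction_piPresentation_levelTopology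
    (h37 : 𝒢.Thm37Hypotheses) (hG : 𝒢.graph.IsGraph) [Finite 𝒢.graph.Vertex] [Finite 𝒢.graph.Branch]
    {PA : Type u} [Group PA] [TopologicalSpace PA] [IsTopologicalGroup PA] [CompactSpace PA]
    (hA : IsTempered PA)
    (ρ' : PA →* TopOut (𝒢.temperedPiChart h37.toProp36Hypotheses).G) (baseAct : PA →* Aut 𝒢.graph)
    [inst : TopologicalSpace (outerSemidirectProduct ρ')]
    (T : ∀ w : 𝒢.graph.Vertex, (𝒢.galoisLevelData h37.toProp36Hypotheses).PointSeq h37.toProp36Hypotheses.isCountable w) (R : SemiGraph.RefBranches 𝒢.graph)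
    (Rc : ChartRepresentatives (𝒢.temperedPiChart h37.toProp36Hypotheses))
    (hV : ∀ (a : PA) (v : 𝒢.graph.Vertex) (H : Subgroup (𝒢.temperedPiChart h37.toProp36Hypotheses).G), H ∈ verticialSubgroups (𝒢.temperedPiChart h37.toProp36Hypotheses) v →
      ∃ φ : contMulAut (𝒢.temperedPiChart h37.toProp36Hypotheses).G, TopOut.mk (𝒢.temperedPiChart h37.toProp36Hypotheses).G φ = ρ' a ∧
        H.map (φ : MulAut (𝒢.temperedPiChart h37.toProp36Hypotheses).G).toMonoidHom ∈ verticialSubgroups (𝒢.temperedPiChart h37.toProp36Hypotheses) ((baseAct a).hom.vertexMap v))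
    (hE : ∀ (a : PA) (e : 𝒢.graph.Edge) (K : Subgroup (𝒢.temperedPiChart h37.toProp36Hypotheses).G), K ∈ edgeLikeSubgroups (𝒢.temperedPiChart h37.toProp36Hypotheses) e →
      ∃ φ : contMulAut (𝒢.temperedPiChart h37.toProp36Hypotheses).G, TopOut.mk (𝒢.temperedPiChart h37.toProp36Hypotheses).G φ = ρ' a ∧
        K.map (φ : MulAut (𝒢.temperedPiChart h37.toProp36Hypotheses).G).toMonoidHom ∈ edgeLikeSubgroups (𝒢.temperedPiChart h37.toProp36Hypotheses) ((baseAct a).hom.edgeMap e))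
    (hopen : ∃ U : Subgroup PA, IsOpen (U : Set PA) ∧ ∀ a ∈ U,
      (∀ v, (baseAct a).hom.vertexMap v = v) ∧ (∀ e, (baseAct a).hom.edgeMap e = e) ∧
        ∀ b, (baseAct a).hom.branchMap b = b)
    (hBR : ∀ (a : PA) (b : 𝒢.graph.Branch) (v : 𝒢.graph.Vertex) (hb : 𝒢.graph.abuts b = some v)
      (φ : 𝒢.Gv v →ₜ* (𝒢.temperedPiChart h37.toProp36Hypotheses).G), IsVerticialHom (𝒢.temperedPiChart h37.toProp36Hypotheses) v φ →
      ∃ Φ : contMulAut (𝒢.temperedPiChart h37.toProp36Hypotheses).G, TopOut.mk (𝒢.temperedPiChart h37.toProp36Hypotheses).G Φ = ρ' a ∧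
        ∃ φ' : 𝒢.Gv ((baseAct a).hom.vertexMap v) →ₜ* (𝒢.temperedPiChart h37.toProp36Hypotheses).G,
          IsVerticialHom (𝒢.temperedPiChart h37.toProp36Hypotheses) ((baseAct a).hom.vertexMap v) φ' ∧ ∃ x' : (𝒢.temperedPiChart h37.toProp36Hypotheses).G,
            Subgroup.map (Φ : MulAut (𝒢.temperedPiChart h37.toProp36Hypotheses).G).toMonoidHom φ.toMonoidHom.range =
              Subgroup.map (MulAut.conj x').toMonoidHom φ'.toMonoidHom.range ∧
            Subgroup.map (Φ : MulAut (𝒢.temperedPiChart h37.toProp36Hypotheses).G).toMonoidHom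
                (Subgroup.map φ.toMonoidHom (𝒢.branchSubgroup b v hb)) =
              Subgroup.map (MulAut.conj x').toMonoidHom
                (Subgroup.map φ'.toMonoidHom
                  (𝒢.branchSubgroup ((baseAct a).hom.branchMap b) ((baseAct a).hom.vertexMap v)
                    ((baseAct a).hom.abuts_branchMap b v hb))))
    (hP : ((𝒢.galoisLevelData h37.toProp36Hypotheses).piPresentation h37.toProp36Hypotheses.isCountable T R).IsArithCompatible (((contMulAut (𝒢.temperedPiChart h37.toProp36Hypotheses).G).subtype.comp (MonoidHom.fst (contMulAut (𝒢.temperedPiChart h37.toProp36Hypotheses).G) PA)).comp (outerSemidirectProduct ρ').subtype) (baseAct.comp (outerSemidirectProductSnd ρ')))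
    (w₀ : 𝒢.graph.Vertex)
    (hLst : ∀ (n : ℕ) (e : outerSemidirectProduct ρ') (x : (𝒢.temperedPiChart h37.toProp36Hypotheses).G), x ∈ ((𝒢.galoisLevelData h37.toProp36Hypotheses).piLevelAut h37.toProp36Hypotheses.isCountable (𝒢.galoisLevelData_hconn h37.toProp36Hypotheses) n).ker → (((contMulAut (𝒢.temperedPiChart h37.toProp36Hypotheses).G).subtype.comp (MonoidHom.fst (contMulAut (𝒢.temperedPiChart h37.toProp36Hypotheses).G) PA)).comp (outerSemidirectProduct ρ').subtype) e x ∈ ((𝒢.galoisLevelData h37.toProp36Hypotheses).piLevelAut h37.toProp36Hypotheses.isCountable (𝒢.galoisLevelData_hconn h37.toProp36Hypotheses) n).ker)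
    (hK1' : ∀ n, IsOpen (((((𝒢.galoisLevelData h37.toProp36Hypotheses).piPresentation h37.toProp36Hypotheses.isCountable T R).levelKer hP
        ((𝒢.galoisLevelData h37.toProp36Hypotheses).projAut h37.toProp36Hypotheses.isCountable n).ker
        ((𝒢.galoisLevelData h37.toProp36Hypotheses).hKst_of_hLst_outerAction h37.toProp36Hypotheses.isCountable (𝒢.galoisLevelData_hconn h37.toProp36Hypotheses) T R ρ' hP hLst n)).map (outerSemidirectProductSnd ρ') :
      Subgroup PA) : Set PA))
    -- the topology of `E` IS the canonical level topology
    (hinst : inst = canonicalArithLevelTopology h37 hA ρ' baseAct T R hP w₀ hLst hK1')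
    (noSwitchBase : NoBranchSwitching 𝒢.graph.edgeOf
      (fun (a : PA) (b : 𝒢.graph.Branch) => (baseAct a).hom.branchMap b))
    (stabBranchPairAug : ∀ (C : Subgroup (outerSemidirectProduct ρ')),
      IsCompact (C : Set (outerSemidirectProduct ρ')) →
      ∀ (j₀ : ℕ) (w : ∀ i : {i : ℕ // j₀ ≤ i}, (((𝒢.galoisLevelData h37.toProp36Hypotheses).piPresentation h37.toProp36Hypotheses.isCountable T R).cosetGraph ((𝒢.galoisLevelData h37.toProp36Hypotheses).piLevelAut h37.toProp36Hypotheses.isCountable (𝒢.galoisLevelData_hconn h37.toProp36Hypotheses) i.1).ker).Vertex)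
      (β β' : ∀ i : {i : ℕ // j₀ ≤ i}, (((𝒢.galoisLevelData h37.toProp36Hypotheses).piPresentation h37.toProp36Hypotheses.isCountable T R).cosetGraph ((𝒢.galoisLevelData h37.toProp36Hypotheses).piLevelAut h37.toProp36Hypotheses.isCountable (𝒢.galoisLevelData_hconn h37.toProp36Hypotheses) i.1).ker).Branch),
      (∀ i, β i ≠ β' i ∧ (((𝒢.galoisLevelData h37.toProp36Hypotheses).piPresentation h37.toProp36Hypotheses.isCountable T R).cosetGraph ((𝒢.galoisLevelData h37.toProp36Hypotheses).piLevelAut h37.toProp36Hypotheses.isCountable (𝒢.galoisLevelData_hconn h37.toProp36Hypotheses) i.1).ker).abuts (β i) = some (w i) ∧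
        (((𝒢.galoisLevelData h37.toProp36Hypotheses).piPresentation h37.toProp36Hypotheses.isCountable T R).cosetGraph ((𝒢.galoisLevelData h37.toProp36Hypotheses).piLevelAut h37.toProp36Hypotheses.isCountable (𝒢.galoisLevelData_hconn h37.toProp36Hypotheses) i.1).ker).abuts (β' i) = some (w i)) →
      (∀ ⦃i i' : {i : ℕ // j₀ ≤ i}⦄ (h : i.1 ≤ i'.1),
        (((𝒢.galoisLevelData h37.toProp36Hypotheses).piPresentation h37.toProp36Hypotheses.isCountable T R).cosetGraphTrans ((𝒢.galoisLevelData h37.toProp36Hypotheses).ker_piLevelAut_anti h37.toProp36Hypotheses.isCountable (𝒢.galoisLevelData_hconn h37.toProp36Hypotheses) h)).vertexMap (w i') = w i ∧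
        (((𝒢.galoisLevelData h37.toProp36Hypotheses).piPresentation h37.toProp36Hypotheses.isCountable T R).cosetGraphTrans ((𝒢.galoisLevelData h37.toProp36Hypotheses).ker_piLevelAut_anti h37.toProp36Hypotheses.isCountable (𝒢.galoisLevelData_hconn h37.toProp36Hypotheses) h)).branchMap (β i') = β i ∧
          (((𝒢.galoisLevelData h37.toProp36Hypotheses).piPresentation h37.toProp36Hypotheses.isCountable T R).cosetGraphTrans ((𝒢.galoisLevelData h37.toProp36Hypotheses).ker_piLevelAut_anti h37.toProp36Hypotheses.isCountable (𝒢.galoisLevelData_hconn h37.toProp36Hypotheses) h)).branchMap (β' i') = β' i) →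
      (∀ (i : {i : ℕ // j₀ ≤ i}) (g : outerSemidirectProduct ρ'), g ∈ C →
        (((𝒢.galoisLevelData h37.toProp36Hypotheses).piPresentation h37.toProp36Hypotheses.isCountable T R).arithAct hP ((𝒢.galoisLevelData h37.toProp36Hypotheses).piLevelAut h37.toProp36Hypotheses.isCountable (𝒢.galoisLevelData_hconn h37.toProp36Hypotheses) i.1).ker (hLst i.1) g).hom.vertexMap (w i) = w i ∧
        (((𝒢.galoisLevelData h37.toProp36Hypotheses).piPresentation h37.toProp36Hypotheses.isCountable T R).arithAct hP ((𝒢.galoisLevelData h37.toProp36Hypotheses).piLevelAut h37.toProp36Hypotheses.isCountable (𝒢.galoisLevelData_hconn h37.toProp36Hypotheses) i.1).ker (hLst i.1) g).hom.branchMap (β i) = β i ∧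
          (((𝒢.galoisLevelData h37.toProp36Hypotheses).piPresentation h37.toProp36Hypotheses.isCountable T R).arithAct hP ((𝒢.galoisLevelData h37.toProp36Hypotheses).piLevelAut h37.toProp36Hypotheses.isCountable (𝒢.galoisLevelData_hconn h37.toProp36Hypotheses) i.1).ker (hLst i.1) g).hom.branchMap (β' i) = β' i) →
      ∃ (v : 𝒢.graph.Vertex) (b b' : 𝒢.graph.Branch) (a : PA) (h : outerSemidirectProduct ρ'),
        (decompositionDataOfChart Rc (toOuterSemidirectProduct ρ')).abut b = some v ∧ (decompositionDataOfChart Rc (toOuterSemidirectProduct ρ')).abut b' = some v ∧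
        h ∈ (decompositionDataOfChart Rc (toOuterSemidirectProduct ρ')).vertGp v ∧ (b' ≠ b ∨ h ∉ (decompositionDataOfChart Rc (toOuterSemidirectProduct ρ')).brGp b) ∧
        C.map (outerSemidirectProductSnd ρ') ≤ conjSubgroup a (((decompositionDataOfChart Rc (toOuterSemidirectProduct ρ')).brGp b ⊓
          conjSubgroup h ((decompositionDataOfChart Rc (toOuterSemidirectProduct ρ')).brGp b')).map (outerSemidirectProductSnd ρ')))
    (hest : IsTotallyArithEstranged (decompositionDataOfChart Rc (toOuterSemidirectProduct ρ')) (outerSemidirectProductSnd ρ')) (hbot : ¬ IsArithAmple (outerSemidirectProductSnd ρ') ⊥) :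
    ArithMaximalCompactStatementI (decompositionDataOfChart Rc (toOuterSemidirectProduct ρ')) (outerSemidirectProductSnd ρ') ∧
      ArithMaximalCompactStatementII (decompositionDataOfChart Rc (toOuterSemidirectProduct ρ')) (outerSemidirectProductSnd ρ') := by
  subst hinst
  -- the package's data at the canonical tower
  haveI hfc : FirstCountableTopology (𝒢.temperedPiChart h37.toProp36Hypotheses).G :=
    TemperedPiChart.firstCountableTopology_G _
  letI : TopologicalSpace (outerSemidirectProduct ρ') := canonicalArithLevelTopology h37 hA ρ' baseAct T R hP w₀ hLst hK1'
  haveI := arithLevelTopology_isTopologicalGroup (𝒢.temperedPiChart h37.toProp36Hypotheses) ρ' baseAct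
    h37.toProp36Hypotheses hA _ hP w₀
    ((𝒢.galoisLevelData h37.toProp36Hypotheses).isCompact_piPresentation_H h37.toProp36Hypotheses.isCountable T R w₀)
    (fun n => ((𝒢.galoisLevelData h37.toProp36Hypotheses).projAut h37.toProp36Hypotheses.isCountable n).ker)
    (fun _ => MonoidHom.normal_ker _)
    ((𝒢.galoisLevelData h37.toProp36Hypotheses).hKst_of_hLst_outerAction h37.toProp36Hypotheses.isCountable (𝒢.galoisLevelData_hconn h37.toProp36Hypotheses) T R ρ' hP hLst)
    ((𝒢.galoisLevelData h37.toProp36Hypotheses).ker_projAut_anti h37.toProp36Hypotheses.isCountable)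
    ((𝒢.galoisLevelData h37.toProp36Hypotheses).isOpen_ker_projAut h37.toProp36Hypotheses.isCountable)
    (fun _ hU => (𝒢.galoisLevelData h37.toProp36Hypotheses).exists_ker_projAut_subset h37.toProp36Hypotheses.isCountable hU)
    hK1'
  haveI := arithLevelTopology_t2Space (𝒢.temperedPiChart h37.toProp36Hypotheses) ρ' baseAct
    h37.toProp36Hypotheses hA _ hP w₀
    ((𝒢.galoisLevelData h37.toProp36Hypotheses).isCompact_piPresentation_H h37.toProp36Hypotheses.isCountable T R w₀)
    (fun n => ((𝒢.galoisLevelData h37.toProp36Hypotheses).projAut h37.toProp36Hypotheses.isCountable n).ker)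
    (fun _ => MonoidHom.normal_ker _)
    ((𝒢.galoisLevelData h37.toProp36Hypotheses).hKst_of_hLst_outerAction h37.toProp36Hypotheses.isCountable (𝒢.galoisLevelData_hconn h37.toProp36Hypotheses) T R ρ' hP hLst)
    ((𝒢.galoisLevelData h37.toProp36Hypotheses).ker_projAut_anti h37.toProp36Hypotheses.isCountable)
    ((𝒢.galoisLevelData h37.toProp36Hypotheses).isOpen_ker_projAut h37.toProp36Hypotheses.isCountable)
    (fun _ hU => (𝒢.galoisLevelData h37.toProp36Hypotheses).exists_ker_projAut_subset h37.toProp36Hypotheses.isCountable hU)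
    hK1'
  exact arithMaximalCompactStatement_outerAction_piPresentation_of_producers h37 hG ρ' baseAct T R Rc hV hE hopen
    hBR hP w₀ hLst
    (isOpen_ker_arithAct (𝒢.temperedPiChart h37.toProp36Hypotheses) ρ' baseAct h37.toProp36Hypotheses hA _ hP w₀
      ((𝒢.galoisLevelData h37.toProp36Hypotheses).isCompact_piPresentation_H h37.toProp36Hypotheses.isCountable T R w₀)
      _ (fun _ => MonoidHom.normal_ker _) _
      ((𝒢.galoisLevelData h37.toProp36Hypotheses).ker_projAut_anti h37.toProp36Hypotheses.isCountable)
      ((𝒢.galoisLevelData h37.toProp36Hypotheses).isOpen_ker_projAut h37.toProp36Hypotheses.isCountable)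
      (fun _ hU => (𝒢.galoisLevelData h37.toProp36Hypotheses).exists_ker_projAut_subset h37.toProp36Hypotheses.isCountable hU)
      hK1')
    (isTempered_arithLevelTopology (𝒢.temperedPiChart h37.toProp36Hypotheses) ρ' baseAct h37.toProp36Hypotheses hA _ hP w₀
      ((𝒢.galoisLevelData h37.toProp36Hypotheses).isCompact_piPresentation_H h37.toProp36Hypotheses.isCountable T R w₀)
      _ (fun _ => MonoidHom.normal_ker _) _
      ((𝒢.galoisLevelData h37.toProp36Hypotheses).ker_projAut_anti h37.toProp36Hypotheses.isCountable)
      ((𝒢.galoisLevelData h37.toProp36Hypotheses).isOpen_ker_projAut h37.toProp36Hypotheses.isCountable)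
      (fun _ hU => (𝒢.galoisLevelData h37.toProp36Hypotheses).exists_ker_projAut_subset h37.toProp36Hypotheses.isCountable hU)
      hK1')
    (arithLevelTopology_nhds_hasBasis (𝒢.temperedPiChart h37.toProp36Hypotheses) ρ' baseAct h37.toProp36Hypotheses hA _ hP w₀
      ((𝒢.galoisLevelData h37.toProp36Hypotheses).isCompact_piPresentation_H h37.toProp36Hypotheses.isCountable T R w₀)
      _ (fun _ => MonoidHom.normal_ker _) _
      ((𝒢.galoisLevelData h37.toProp36Hypotheses).ker_projAut_anti h37.toProp36Hypotheses.isCountable)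
      ((𝒢.galoisLevelData h37.toProp36Hypotheses).isOpen_ker_projAut h37.toProp36Hypotheses.isCountable)
      (fun _ hU => (𝒢.galoisLevelData h37.toProp36Hypotheses).exists_ker_projAut_subset h37.toProp36Hypotheses.isCountable hU)
      hK1')
    hK1' noSwitchBase stabBranchPairAug hest hbot

end ProfiniteSemiGraph

end Literature.AnabelianGeometry.SemiGraphs
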